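import Summits.KontsevichZagierPeriods.KontsevichZagierPeriods.Theorems.HermiteRigidityDilogRigidityCubeTwoSeries
import Summits.KontsevichZagierPeriods.KontsevichZagierPeriods.Theorems.HermiteRigidityDilogRigidityCubeTwoSeriesLevel
import Mathlib.MeasureTheory.Integral.Pi
import Mathlib.MeasureTheory.Integral.DominatedConvergence
import Mathlib.Analysis.SpecificLimits.Basic
import Mathlib.Analysis.SpecialFunctions.Integrals.Basic

/-!
# `ReductionRigidity` (stmt-KontsevichZagierPeriods-3407), line `Sketch` (growth programme
# `DilogRigidity`, wave 3): stub `stub_cubeIntegralSeriesLevel`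

THE VALUE OF THE WEIGHT-`i` NORMAL FORM AS A POLYLOGARITHM SERIES, AT A REAL LEVEL. For every
dimension `i` and every real `ν ≥ 2`,

  `L_i = ∫_{[0,1]^i} dx / (ν − ∏_l x_l) = ∑_{k ≥ 0} ν^{-(k+1)} / (k+1)^i = Li_i(1/ν)`.

This is the every-weight generalisation of the landed weight-two statements
`stub_cubeTwoIntegralSeries` (integer level, `HermiteRigidityDilogRigidityCubeTwoSeries.lean`) and
`stub_cubeTwoIntegralSeriesLevel` (real level, `HermiteRigidityDilogRigidityCubeTwoSeriesLevel.lean`):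
at `i = 2` the product `∏_{l : Fin 2} p l` is `p 0 * p 1` (`Fin.prod_univ_two`), so the weight-two
statement is the specialisation of the present one. It identifies the normal-form values `L_i`,
`i ≤ w`, of the every-weight Padé box islands with the polylogarithm values `Li_i(1/ν)` used by the
lead's `ℚ`-linear independence argument for `1, Li_1(1/N), …, Li_w(1/N)`.

Proof (termwise integration of the geometric expansion, uniformly in the dimension `i`, including
`i = 0`, where the cube is the one-point space of volume `1`, the empty product is `1`, and both sides
equal `1/(ν − 1) = ∑_k ν^{-(k+1)}`):
* on the cube `u = ∏_l x_l ∈ [0, 1]` (`Finset.prod_nonneg`, `Finset.prod_le_one`) and `ν ≥ 2`, so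
  `0 ≤ u/ν < 1` and `1/(ν − u) = (1/ν) · 1/(1 − u/ν) = ∑_k (1/ν)^{k+1} u^k`
  (`hasSum_geometric_of_lt_one`);
* `∫` and `∑` are swapped by `MeasureTheory.integral_tsum_of_summable_integral_norm`: each term is
  continuous on the compact cube, nonnegative there, and its integral is `(1/ν)^{k+1}/(k+1)^i`, a
  summable sequence (dominated by the geometric series `∑ (1/ν)^{k+1}`, as `1 ≤ (k+1)^i`);
* termwise, `∫_{[0,1]^i} (∏_l x_l)^k = ∏_l ∫₀¹ x^k = (1/(k+1))^i` by Fubini on `Fin i → ℝ`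
  (`Finset.prod_pow`, `cube_eq_pi`, `Measure.restrict_pi_pi`, `integral_fintype_prod_eq_pow`) and
  the tree's one-variable moment `CalegariDimitrovTang.setIntegral_Icc_pow`.
-/

noncomputable section

open MeasureTheory Set

namespace Summit.KontsevichZagierPeriods.HermiteRigidity.ReductionRigidity

open Literature.NumberTheory.Transcendental
open Literature.NumberTheory.Transcendental.KZ

/-! ## Termwise integrals `∫_{[0,1]^i} (∏_l x_l)^k dx = 1/(k+1)^i` -/

/-- Fubini on the `i`-cube: `∫_{[0,1]^i} (∏_l x_l)^k dx = (∫₀¹ x^k dx)^i = 1/(k+1)^i` (the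
one-variable moment `∫₀¹ x^k dx = 1/(k+1)` is the tree's `CalegariDimitrovTang.setIntegral_Icc_pow`;
the statement includes `i = 0`, where both sides are `1`). [folklore] -/
theorem integral_cube_prod_pow (i k : ℕ) :
    ∫ p in cube i, (∏ l, p l) ^ k = 1 / ((k : ℝ) + 1) ^ i := by
  have h1 : ∀ p : Fin i → ℝ, (∏ l, p l) ^ k = ∏ l : Fin i, (p l) ^ k := fun p =>
    (Finset.prod_pow Finset.univ k p).symm
  simp_rw [h1]
  rw [cube_eq_pi, volume_pi, Measure.restrict_pi_pi]
  have h := integral_fintype_prod_eq_pow (ι := Fin i) (fun x : ℝ => x ^ k)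
    (μ := volume.restrict (Icc (0 : ℝ) 1))
  rw [Fintype.card_fin] at h
  rw [h, CalegariDimitrovTang.setIntegral_Icc_pow, one_div_pow]

/-- On the cube the product of the coordinates lies in `[0, 1]`. [folklore] -/
theorem prod_mem_unitInterval_of_mem_cube {i : ℕ} {p : Fin i → ℝ} (hp : p ∈ cube i) :
    0 ≤ ∏ l, p l ∧ ∏ l, p l ≤ 1 :=
  ⟨Finset.prod_nonneg fun l _ => (hp l).1,
    Finset.prod_le_one (fun l _ => (hp l).1) fun l _ => (hp l).2⟩

/-! ## The series `∫_{[0,1]^i} dx/(ν − ∏ x) = ∑_k ν^{-(k+1)}/(k+1)^i` for real `ν ≥ 2` -/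

/-- **The weight-`i` normal form as a polylogarithm series, real level**: for every dimension `i`
and every real `ν ≥ 2`,
`∫_{[0,1]^i} dx/(ν − ∏_l x_l) = ∑_{k ≥ 0} (1/ν)^{k+1}/(k+1)^i (= Li_i(1/ν))`, by termwise
integration of the geometric expansion `1/(ν − u) = ∑_k u^k/ν^{k+1}`, `u = ∏_l x_l` (absolutely
convergent on the closed cube since `0 ≤ u/ν ≤ 1/2`). At `i = 2` this is
`stub_cubeTwoIntegralSeriesLevel` (`∏_{l : Fin 2} p l = p 0 * p 1`). [folklore] -/
theorem stub_cubeIntegralSeriesLevel : ∀ (i : ℕ) (ν : ℝ), 2 ≤ ν →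
    ∫ p in cube i, 1 / (ν - ∏ l, p l) = ∑' k : ℕ, (1 / ν) ^ (k + 1) / ((k : ℝ) + 1) ^ i := by
  intro i ν hν
  have hνpos : (0 : ℝ) < ν := by linarith
  -- the terms of the expansion
  set F : ℕ → (Fin i → ℝ) → ℝ := fun k p => (1 / ν) ^ (k + 1) * (∏ l, p l) ^ k with hF
  -- bounds on `u = ∏ x` on the cube
  have hu : ∀ p ∈ cube i, 0 ≤ ∏ l, p l ∧ ∏ l, p l ≤ 1 := fun p hp =>
    prod_mem_unitInterval_of_mem_cube hp
  -- pointwise geometric expansion on the cube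
  have hexp : EqOn (fun p : Fin i → ℝ => 1 / (ν - ∏ l, p l)) (fun p => ∑' k, F k p)
      (cube i) := by
    intro p hp
    obtain ⟨h0, h1⟩ := hu p hp
    have hr0 : 0 ≤ (∏ l, p l) / ν := div_nonneg h0 hνpos.le
    have hr1 : (∏ l, p l) / ν < 1 := by
      rw [div_lt_one hνpos]; linarith
    have hgeom := (hasSum_geometric_of_lt_one hr0 hr1).mul_left (1 / ν)
    have hval : 1 / ν * (1 - (∏ l, p l) / ν)⁻¹ = 1 / (ν - ∏ l, p l) := by
      have hne : ν - ∏ l, p l ≠ 0 := by linarith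
      field_simp
    have hterm : (fun k : ℕ => 1 / ν * ((∏ l, p l) / ν) ^ k) = fun k => F k p := by
      funext k
      simp only [hF]
      ring
    rw [hval, hterm] at hgeom
    exact hgeom.tsum_eq.symm
  -- each term is integrable on the cube
  have hint : ∀ k, Integrable (F k) (volume.restrict (cube i)) := by
    intro k
    have hc : Continuous (F k) := by
      simp only [hF]
      fun_prop
    exact hc.continuousOn.integrableOn_compact isCompact_cube
  -- the value of each termwise integral
  have hval : ∀ k, ∫ p in cube i, F k p = (1 / ν) ^ (k + 1) / ((k : ℝ) + 1) ^ i := by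
    intro k
    simp only [hF]
    rw [integral_const_mul, integral_cube_prod_pow, mul_one_div]
  -- the norms: `‖F k p‖ = F k p` on the cube
  have hnorm : ∀ k, ∫ p in cube i, ‖F k p‖ = (1 / ν) ^ (k + 1) / ((k : ℝ) + 1) ^ i := by
    intro k
    rw [← hval k]
    refine setIntegral_congr_fun measurableSet_cube fun p hp => ?_
    simp only [hF]
    exact Real.norm_of_nonneg
      (mul_nonneg (pow_nonneg (by positivity) _) (pow_nonneg (hu p hp).1 _))
  -- summability of the norms: dominated by the geometric series `∑ (1/ν)^(k+1)`
  have hsum : Summable fun k => ∫ p in cube i, ‖F k p‖ := by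
    simp_rw [hnorm]
    have hq0 : 0 ≤ 1 / ν := by positivity
    have hq1 : 1 / ν < 1 := by rw [div_lt_one hνpos]; linarith
    have hg : Summable fun k : ℕ => 1 / ν * (1 / ν) ^ k :=
      (summable_geometric_of_lt_one hq0 hq1).mul_left _
    refine Summable.of_nonneg_of_le (fun k => by positivity) (fun k => ?_) hg
    rw [← pow_succ']
    have hk : (1 : ℝ) ≤ ((k : ℝ) + 1) ^ i :=
      one_le_pow₀ (by linarith [(k.cast_nonneg : (0 : ℝ) ≤ k)])
    exact div_le_self (pow_nonneg hq0 (k + 1)) hk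
  -- termwise integration
  rw [setIntegral_congr_fun measurableSet_cube hexp,
    ← integral_tsum_of_summable_integral_norm hint hsum]
  exact tsum_congr hval

end Summit.KontsevichZagierPeriods.HermiteRigidity.ReductionRigidity
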